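import Mathlib
import HarnessLib
import Summits.NavierStokesRegularity.NavierStokesRegularity.Theorems.PoloidalWindowDoorLrcModEntireThreadFlatHotSpot
import Summits.NavierStokesRegularity.NavierStokesRegularity.Theorems.PoloidalWindowDoorLrcModEntireQuarticRadial

/-!
# Route `PoloidalWindowDoor`, item `LrcModEntire` (stmt-NavierStokesRegularity-20428) / crux K2 (stmt-19708) —
# the QUARTIC LEAF PACKAGE at a flat threaded hot spot (thread_axis S3′, quartic-nondegenerate sub-case)

LEAD of item 20428 ns-poloidal-K2-p3 g10 (`--supports stmt-NavierStokesRegularity-20428 --as helper`).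
Glue of the free pins of a FLAT threaded hot spot (`…ThreadFlatHotSpot`, `…ThreadQuarticPin`, `…ThreadPressure`) with the abstract
calculus `…QuarticMax.quarticMax` / `…QuarticRadial.quarticRadialNeg`: for a profile of the class whose scale-invariant vertical size
peaks at `(−1,0)` with `V := v₂(−1,0) ≠ 0`, a flat horizontal direction `e` (S3′'s non-Morse hypothesis) and ANY direction `p` with the
two NON-DEGENERACY conditions `D²v₂(−1,·)(0)[p,p] ≠ 0`, `D⁴v₂(−1,·)(0)[e,e,e,e] ≠ 0` and the discriminant condition `27B² < 8AQ`
(`A, Q` the two quantities, `B = (d²/dy²)|₀ Dv₂(−1,·)(ye)p`; the SIGNS of `A, Q` are free — `V·A ≤ 0`, `V·Q ≤ 0` by the pins):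
on the plane `{xp + ye}` near `0`, `V·v₂(−1, xp+ye) < V²` (strict extremum) and `V·Dv₂(−1,·)(z)z < 0` (radial monotonicity), `z = xp + ye ≠ 0`
— the hypotheses of `…RadialLevels` (one crossing per ray: the leaves are closed star-shaped curves about the thread), WITHOUT Morse.
* `flatHotSpotLeafPackage` — the package.
WHAT THIS IS NOT: not S3′, not a claim about Navier–Stokes regularity — calculus at a hot spot (bears_on LADDER-NS N0, rung N0-LocalTubeDoorPoloidal). [folklore]
-/

noncomputable section

-- the summit and its single sub-problem share the name (CONVENTIONS §1), as in every Theorems file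
set_option linter.dupNamespace false

namespace Summit.NavierStokesRegularity.NavierStokesRegularity.Theorems.PoloidalWindowDoorLrcModEntireThreadFlatLeafPackage

open MeasureTheory Set Function Filter Topology
open scoped RealInnerProductSpace InnerProductSpace
open Literature.Analysis Literature.Analysis.FluidPDE Literature.Analysis.UnboundedOperators
open Summit.NavierStokesRegularity.NavierStokesRegularity.Theorems.LocalSineTubeDoorProfileAlignedWindowRigidityAncient
open Summit.NavierStokesRegularity.NavierStokesRegularity.Theorems.PoloidalWindowDoorLrcModEntireThreadPins
open Summit.NavierStokesRegularity.NavierStokesRegularity.Theorems.PoloidalWindowDoorLrcModEntireThreadQuarticPin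
open Summit.NavierStokesRegularity.NavierStokesRegularity.Theorems.PoloidalWindowDoorLrcModEntireThreadFlatHotSpot
open Summit.NavierStokesRegularity.NavierStokesRegularity.Theorems.PoloidalWindowDoorLrcModEntireQuarticMax
open Summit.NavierStokesRegularity.NavierStokesRegularity.Theorems.PoloidalWindowDoorLrcModEntireQuarticRadial

variable {v : ℝ → EuclideanSpace ℝ (Fin 3) → EuclideanSpace ℝ (Fin 3)} {C : ℝ}

/-- **QUARTIC LEAF PACKAGE at a flat threaded hot spot.** See the module docstring. [folklore] -/
theorem flatHotSpotLeafPackage (hrate : HasTypeITimeDecay C v) (hcont : ContinuousOn (uncurry v) (Iio (0 : ℝ) ×ˢ univ))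
    (hmild : ∀ s t : ℝ, s < t → t < 0 → ∀ x, v t x = heatExtension (v s) (t - s) x - oseenDuhamel 1 s v v t x)
    (hne : v (-1) 0 2 ≠ 0) (hhot : ∀ t < 0, ∀ x, Real.sqrt (-t) * |v t x 2| ≤ |v (-1) 0 2|)
    {e : EuclideanSpace ℝ (Fin 3)} (hflat : fderiv ℝ (fun x => fderiv ℝ (fun y => v (-1) y 2) x e) 0 e = 0)
    (p : EuclideanSpace ℝ (Fin 3)) (hA0 : iteratedFDeriv ℝ 2 (fun y => v (-1) y 2) 0 ![p, p] ≠ 0)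
    (hQ0 : iteratedFDeriv ℝ 4 (fun y => v (-1) y 2) 0 (fun _ => e) ≠ 0)
    (hdisc : 27 * (iteratedDeriv 2 (fun y : ℝ => fderiv ℝ (fun z => v (-1) z 2) (y • e) p) 0) ^ 2 <
      8 * iteratedFDeriv ℝ 2 (fun y => v (-1) y 2) 0 ![p, p] * iteratedFDeriv ℝ 4 (fun y => v (-1) y 2) 0 (fun _ => e)) :
    ∃ ρ > 0, ∀ x y : ℝ, |x| < ρ → |y| < ρ → (x ≠ 0 ∨ y ≠ 0) →
      v (-1) 0 2 * v (-1) (x • p + y • e) 2 < v (-1) 0 2 * v (-1) 0 2 ∧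
        v (-1) 0 2 * fderiv ℝ (fun z => v (-1) z 2) (x • p + y • e) (x • p + y • e) < 0 := by
  -- the slice component `f` and its sign-normalised version `g = σ • f`
  set f : EuclideanSpace ℝ (Fin 3) → ℝ := fun y => v (-1) y 2 with hf
  have hfa : ContDiff ℝ 4 f := by
    have hsl := analyticOnNhd_slice hcont (bdd_of_hasTypeITimeDecay hrate) hmild (by norm_num : (-1 : ℝ) < 0)
    have han : AnalyticOnNhd ℝ f univ := fun y _ =>
      ((EuclideanSpace.proj (𝕜 := ℝ) (2 : Fin 3)).analyticAt _).comp (hsl y (mem_univ _))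
    exact han.contDiff
  have hfa2 : ContDiff ℝ 2 f := hfa.of_le (by norm_num)
  have hfd : Differentiable ℝ f := hfa.differentiable (by norm_num)
  obtain ⟨σ, hσabs, hσa⟩ : ∃ σ : ℝ, |σ| = 1 ∧ σ * v (-1) 0 2 = |v (-1) 0 2| := by
    rcases lt_or_gt_of_ne hne with h | h
    · exact ⟨-1, by simp, by rw [abs_of_neg h]; ring⟩
    · exact ⟨1, by simp, by rw [abs_of_pos h]; ring⟩
  have hσne : σ ≠ 0 := fun h => by rw [h, abs_zero] at hσabs; exact zero_ne_one hσabs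
  have hσ2 : σ * σ = 1 := by
    have h := congrArg (fun r : ℝ => r ^ 2) hσabs
    simp only [sq_abs, one_pow] at h
    nlinarith [h]
  have hVpos : 0 < |v (-1) 0 2| := abs_pos.2 hne
  have haσ : v (-1) 0 2 = |v (-1) 0 2| * σ := by
    calc v (-1) 0 2 = (σ * σ) * v (-1) 0 2 := by rw [hσ2, one_mul]
      _ = (σ * v (-1) 0 2) * σ := by ring
      _ = |v (-1) 0 2| * σ := by rw [hσa]
  set g : EuclideanSpace ℝ (Fin 3) → ℝ := σ • f with hg
  have hgval : ∀ z, g z = σ * f z := fun z => by simp [hg, smul_eq_mul]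
  have hga : ContDiff ℝ 4 g := contDiff_const.smul hfa
  have hgjet : ∀ (k : ℕ) (m : Fin k → EuclideanSpace ℝ (Fin 3)), k ≤ 4 →
      iteratedFDeriv ℝ k g 0 m = σ * iteratedFDeriv ℝ k f 0 m := by
    intro k m hk
    rw [hg, iteratedFDeriv_const_smul_apply ((hfa.of_le (by exact_mod_cast hk)).contDiffAt)]
    simp [smul_eq_mul]
  have hgfd : ∀ z, fderiv ℝ g z = σ • fderiv ℝ f z := fun z => by rw [hg, fderiv_const_smul (hfd z)]
  -- pins of `f` at the hot spot
  have hpin : ∀ h : EuclideanSpace ℝ (Fin 3), fderiv ℝ f 0 h = 0 := fun h => by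
    rw [hf, fderiv_apply_coord (v (-1)) ((analyticOnNhd_slice hcont (bdd_of_hasTypeITimeDecay hrate) hmild
      (by norm_num : (-1 : ℝ) < 0) 0 (mem_univ _)).differentiableAt) h 2]
    exact threadPin_of_hotSpot hrate hcont hmild hhot h
  have hf1 : fderiv ℝ f 0 = 0 := by ext h; rw [hpin h]; simp
  have hflat' : iteratedFDeriv ℝ 2 f 0 ![e, e] = 0 := by
    rw [← PoloidalWindowDoorLrcModEntireThreadFlatHotSpot.fderiv_fderiv_apply_eq_iteratedFDeriv hfa2 0 e e]; exact hflat
  have hflat'' : iteratedFDeriv ℝ 2 f 0 (fun _ => e) = 0 := by rw [const_fin_two]; exact hflat'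
  have hkerf : ∀ w, iteratedFDeriv ℝ 2 f 0 ![e, w] = 0 := threadFlatKernel hrate hcont hmild hne hhot hflat'
  obtain ⟨h3f, h4f⟩ := threadQuarticPin hrate hcont hmild hne hhot hflat''
  have hAf := PoloidalWindowDoorLrcModEntireThreadPressure.threadHessianPin hrate hcont hmild hne hhot p
  -- signs: `σ A < 0`, `σ Q < 0`
  have hsignA : σ * iteratedFDeriv ℝ 2 f 0 ![p, p] < 0 := by
    have hle : σ * iteratedFDeriv ℝ 2 f 0 ![p, p] ≤ 0 := by
      have : |v (-1) 0 2| * (σ * iteratedFDeriv ℝ 2 f 0 ![p, p]) ≤ 0 := by rw [← mul_assoc, ← haσ]; exact hAf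
      nlinarith [this, hVpos]
    exact lt_of_le_of_ne hle (mul_ne_zero hσne hA0)
  have hsignQ : σ * iteratedFDeriv ℝ 4 f 0 (fun _ => e) < 0 := by
    have hle : σ * iteratedFDeriv ℝ 4 f 0 (fun _ => e) ≤ 0 := by
      have : |v (-1) 0 2| * (σ * iteratedFDeriv ℝ 4 f 0 (fun _ => e)) ≤ 0 := by rw [← mul_assoc, ← haσ]; exact h4f
      nlinarith [this, hVpos]
    exact lt_of_le_of_ne hle (mul_ne_zero hσne hQ0)
  -- hypotheses of the abstract theorems for `g`
  have hg1 : fderiv ℝ g 0 = 0 := by rw [hgfd 0, hf1, smul_zero]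
  have hgker : ∀ w, iteratedFDeriv ℝ 2 g 0 ![e, w] = 0 := fun w => by rw [hgjet 2 _ (by norm_num), hkerf w, mul_zero]
  have hgA : iteratedFDeriv ℝ 2 g 0 ![p, p] < 0 := by rw [hgjet 2 _ (by norm_num)]; exact hsignA
  have hg3 : iteratedFDeriv ℝ 3 g 0 (fun _ => e) = 0 := by rw [hgjet 3 _ (by norm_num), h3f, mul_zero]
  have hgQ : iteratedFDeriv ℝ 4 g 0 (fun _ => e) < 0 := by rw [hgjet 4 _ le_rfl]; exact hsignQ
  -- the mixed 1-D quantity: `B_g = σ B_f`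
  have hF1c : ContDiff ℝ 2 (fun y : ℝ => fderiv ℝ f (y • e) p) :=
    ((hfa.fderiv_right (m := 2) (by norm_num)).comp (contDiff_id.smul contDiff_const)).clm_apply contDiff_const
  have hBg : iteratedDeriv 2 (fun y : ℝ => fderiv ℝ g (y • e) p) 0 = σ * iteratedDeriv 2 (fun y : ℝ => fderiv ℝ f (y • e) p) 0 := by
    have hfun : (fun y : ℝ => fderiv ℝ g (y • e) p) = fun y => σ * fderiv ℝ f (y • e) p := by
      funext y; rw [hgfd]; simp [smul_eq_mul]
    rw [hfun, iteratedDeriv_const_mul σ hF1c.contDiffAt]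
  have hσB2 : (σ * iteratedDeriv 2 (fun y : ℝ => fderiv ℝ f (y • e) p) 0) ^ 2 =
      (iteratedDeriv 2 (fun y : ℝ => fderiv ℝ f (y • e) p) 0) ^ 2 := by rw [mul_pow, ← sq_abs σ, hσabs]; ring
  have hσAQ : iteratedFDeriv ℝ 2 g 0 ![p, p] * iteratedFDeriv ℝ 4 g 0 (fun _ => e) =
      iteratedFDeriv ℝ 2 f 0 ![p, p] * iteratedFDeriv ℝ 4 f 0 (fun _ => e) := by
    rw [hgjet 2 _ (by norm_num), hgjet 4 _ le_rfl]
    calc σ * iteratedFDeriv ℝ 2 f 0 ![p, p] * (σ * iteratedFDeriv ℝ 4 f 0 (fun _ => e))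
        = (σ * σ) * (iteratedFDeriv ℝ 2 f 0 ![p, p] * iteratedFDeriv ℝ 4 f 0 (fun _ => e)) := by ring
      _ = _ := by rw [hσ2, one_mul]
  have hdiscM : 3 * (iteratedDeriv 2 (fun y : ℝ => fderiv ℝ g (y • e) p) 0) ^ 2 <
      iteratedFDeriv ℝ 2 g 0 ![p, p] * iteratedFDeriv ℝ 4 g 0 (fun _ => e) := by
    rw [hBg, hσB2, hσAQ]
    nlinarith [hdisc, sq_nonneg (iteratedDeriv 2 (fun y : ℝ => fderiv ℝ f (y • e) p) 0)]
  have hdiscR : 27 * (iteratedDeriv 2 (fun y : ℝ => fderiv ℝ g (y • e) p) 0) ^ 2 <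
      8 * iteratedFDeriv ℝ 2 g 0 ![p, p] * iteratedFDeriv ℝ 4 g 0 (fun _ => e) := by
    rw [hBg, hσB2, mul_assoc, hσAQ, ← mul_assoc]; exact hdisc
  -- the two abstract theorems
  obtain ⟨ρ₁, hρ₁, hM⟩ := quarticMax hga p e hg1 hgker hgA hg3 hgQ hdiscM
  obtain ⟨ρ₂, hρ₂, hR⟩ := quarticRadialNeg hga p e hg1 hgker hgA hg3 hgQ hdiscR
  refine ⟨min ρ₁ ρ₂, lt_min hρ₁ hρ₂, fun x y hx hy hxy => ⟨?_, ?_⟩⟩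
  · have h := hM x y (hx.trans_le (min_le_left _ _)) (hy.trans_le (min_le_left _ _)) hxy
    rw [hgval, hgval] at h
    -- `σ f z < σ V` ⇒ `V f z < V V`
    have h' := mul_lt_mul_of_pos_left h hVpos
    rw [← mul_assoc, ← mul_assoc, ← haσ] at h'
    exact h'
  · have h := hR x y (hx.trans_le (min_le_right _ _)) (hy.trans_le (min_le_right _ _)) hxy
    rw [hgfd] at h
    simp only [FunLike.coe_smul, Pi.smul_apply, smul_eq_mul] at h
    have h' := mul_lt_mul_of_pos_left h hVpos
    rw [mul_zero, ← mul_assoc, ← haσ] at h'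
    exact h'

end Summit.NavierStokesRegularity.NavierStokesRegularity.Theorems.PoloidalWindowDoorLrcModEntireThreadFlatLeafPackage
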